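import Literature.IUT.HodgeArakelov.ModelReconstructionInvarianceTate
import Literature.AnabelianGeometry.EtaleTheta.Discharge.Sec2Cor218iModel

/-!
# Bridge B8, part 8b: THE Def. 1.1 (ii) naturality square at the Tate curve WITHOUT the named FACT Cor. 2.18 (i)
# — its binder `h218i` replaced by the [EtTh] Thm. 1.6 (i) sub-DAG inputs (proof-only)

abc-iut cell, seat abc-iut-L6-d6 (gen 3). Part 8 (`ModelReconstructionInvarianceTate`, p417408) proved the naturality
square `iso_{e ≫ α}[γ g] = iso_e[g]` of THE [IUTchII] Def. 1.1 (ii) cyclotomic rigidity isomorphism at the [EtTh] §1 model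
([IUTchII] Cor. 1.10 «functorial algorithm in `Π`», sub-node C110-S10 at level `N`) modulo abc-iut-L2-t2's named FACT
`RigidData.Cor218_i` (F-0620, FACT-policy) at the model. `Discharge/Sec2Cor218iModel` (p420155) reduces that FACT at the
model to binders that are all recorded, campaign-M rows (K-core extension G-L6d6-2, [AbsAnab] Lem. 1.3.8, the Thm. 1.6 (i)
sub-DAG binders L02 = G-L6d6-1 / L04 = G-w5d051-1 / L05 / L03 = [SemiAnbd] Thm. 6.5 (iii), a cusp of `Y^log`, the Cor. 2.9
label clause). This file is the COMPOSITION: the naturality square (and its «every α» form) at the Tate curve modulo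
exactly those binders + temp-slimness (G-w4d021-3) + the §1 origin hypotheses `IsEtThOrigin`, `hYcl` (G-w4d021-2) — so the
node token of C110-S10 at the model no longer cites a FACT-policy input. Proof-only: no definition, no new named fact;
nothing disputed is asserted; no side is taken on [IUTchIII] Cor. 3.12; typed ≠ discharged.
[claim: Mochizuki2012, status: disputed] (IUTchII §1 Cor 1.10, kurims p.47); [cite: MochizukiEtTh2009, Cor 2.18(i) p.60].
-/

noncomputable section

namespace Literature.IUT.HodgeArakelov

open Literature.AnabelianGeometry.EtaleTheta Literature.AnabelianGeometry.SemiGraphs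
open Literature.AlgebraicGeometry.Frobenioids (IsSlimGroup)
open scoped Literature.AnabelianGeometry.EtaleTheta

namespace ThetaSetting

section Tate

variable {p : ℕ} [Fact p.Prime] {D : Literature.AnabelianGeometry.EtaleTheta.ThetaSetting p}
  {E : D.EtaleThetaData} {l : ℕ} (C : E.DoubleUnderline l) {N : ℕ+} (μ : D.CyclotomeMod l N)
  (hC : D.Compat) (hS : D.Sec2Hyps)

/-- **NATURALITY SQUARE at the Tate curve for EVERY automorphism of the model mono-theta environment, with NO FACT-policy
input**: part 8's `exists_over_coe_cyclotomicRigidity_trans_mk_ofDoubleUnderline` with `Cor218_i` supplied by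
`rigidData_cor218_i_of_thm16Inputs` (p420155). Binders: K-core extension `hext₀` (G-L6d6-2), [AbsAnab] Lem. 1.3.8 `hΔ`,
`Thm16Sub.KerToZIsCompactlyGenerated` (G-L6d6-1), `Thm16Sub.GKNIsKernelOfAction D 2` (G-w5d051-1), `Thm16Sub.GtpYNFromCusp D 2`,
`D.IsoPreservesCuspidalDecomp D`, a cusp of `Y^log` in `Π^tp_Y`, the Cor. 2.9 label clause, temp-slimness `hslimX`
(G-w4d021-3), `IsEtThOrigin`, `hYcl` (G-w4d021-2). [claim: Mochizuki2012, status: disputed] (IUTchII §1 Cor 1.10, kurims p.47) -/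
theorem exists_over_coe_cyclotomicRigidity_trans_mk_ofDoubleUnderline_of_thm16Inputs
    (h15 : Literature.AnabelianGeometry.EtaleTheta.ThetaSetting.Prop15iii E hC) (L : C.CuspLabels)
    (hl : l.Prime) (hp2 : p ≠ 2) (hpl : p ≠ l) (hζ : ∃ ζ : D.K, IsPrimitiveRoot ζ (4 * l))
    {η : (C.thetaEnvData μ hC hS).PiYdd → MuN p N} (hη : η ∈ (C.thetaEnvData μ hC hS).thetaCocycles)
    (hslimX : IsSlimGroup D.PiTemp)
    (hext₀ : ∀ γ : ↥C.Huu ≃ₜ* ↥C.Huu, ∃ Γ : D.PiTemp ≃ₜ* D.PiTemp,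
      ∀ h : C.Huu, Γ (h : D.PiTemp) = ((γ h : C.Huu) : D.PiTemp))
    (hΔ : ∀ Γ : D.PiTemp ≃ₜ* D.PiTemp, D.DeltaTemp.map Γ.toMulEquiv.toMonoidHom = D.DeltaTemp)
    (hZ : Thm16Sub.KerToZIsCompactlyGenerated D) (hK : Thm16Sub.GKNIsKernelOfAction D 2)
    (hYN : Thm16Sub.GtpYNFromCusp D 2) (h65 : D.IsoPreservesCuspidalDecomp D.toTemperedCurve)
    (hex : ∃ Dc : Subgroup D.PiTemp, D.IsCuspidalDecompositionGroup Dc ∧ Dc ≤ D.GtpY)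
    (hcusp : ∀ (γ : ↥C.Huu ≃ₜ* ↥C.Huu) (a : ZMod l),
      (fun H : Subgroup C.Huu => H.map γ.toMulEquiv.toMonoidHom) '' L.cuspX a = L.cuspX a)
    (hO : D.IsEtThOrigin)
    (hYcl : (D.DtpY.map D.toHat.toMonoidHom).topologicalClosure ≤
      D.DtpY.map D.toHat.toMonoidHom ⊔ (⁅⁅D.DeltaHat, D.DeltaHat⁆, D.DeltaHat⁆).topologicalClosure)
    (F : ModelFrame (ofDoubleUnderline C μ hC hS hl hp2 hpl hζ hη) (C.rigidData μ hC hS h15 L))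
    {M : MonoThetaEnv (ofDoubleUnderline C μ hC hS hl hp2 hpl hζ hη)} (e : M.Pi ≃ₜ* (C.rigidData μ hC hS h15 L).env)
    {η' : (C.rigidData μ hC hS h15 L).PiYdd → (C.rigidData μ hC hS h15 L).mu}
    (hη' : η' ∈ (C.rigidData μ hC hS h15 L).thetaCocycles)
    (α : ((C.rigidData μ hC hS h15 L).modelMono hη').Iso ((C.rigidData μ hC hS h15 L).modelMono hη')) :
    ∃ (γ : (C.rigidData μ hC hS h15 L).PiX ≃ₜ* (C.rigidData μ hC hS h15 L).PiX)
      (hL : ∀ g : (C.rigidData μ hC hS h15 L).lDeltaTheta, γ g ∈ (C.rigidData μ hC hS h15 L).lDeltaTheta),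
      (∀ x, ((CycEnvelope.proj (C.rigidData μ hC hS h15 L).augY (C.rigidData μ hC hS h15 L).chi (α.e x) :
          (C.rigidData μ hC hS h15 L).PiY) : (C.rigidData μ hC hS h15 L).PiX) =
        γ ((CycEnvelope.proj (C.rigidData μ hC hS h15 L).augY (C.rigidData μ hC hS h15 L).chi x :
          (C.rigidData μ hC hS h15 L).PiY) : (C.rigidData μ hC hS h15 L).PiX)) ∧
      ∀ g : (C.rigidData μ hC hS h15 L).lDeltaTheta,
        ((F.cyclotomicRigidity (e.trans α.e)).iso
            (((ModelCyclotomes.intCycEquiv (C.rigidData μ hC hS h15 L)).symm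
                ((⟨γ g, hL g⟩ : (C.rigidData μ hC hS h15 L).lDeltaTheta) :
                  ModelCyclotomes.lDeltaQuot (C.rigidData μ hC hS h15 L)) :
                (ModelCyclotomes.intCyc (C.rigidData μ hC hS h15 L)).carrier) :
              ModPow (ModelCyclotomes.intCyc (C.rigidData μ hC hS h15 L)).carrier
                ((ofDoubleUnderline C μ hC hS hl hp2 hpl hζ hη).N : ℕ)) : M.Pi) =
          ((F.cyclotomicRigidity e).iso
            (((ModelCyclotomes.intCycEquiv (C.rigidData μ hC hS h15 L)).symm
                (g : ModelCyclotomes.lDeltaQuot (C.rigidData μ hC hS h15 L)) :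
                (ModelCyclotomes.intCyc (C.rigidData μ hC hS h15 L)).carrier) :
              ModPow (ModelCyclotomes.intCyc (C.rigidData μ hC hS h15 L)).carrier
                ((ofDoubleUnderline C μ hC hS hl hp2 hpl hζ hη).N : ℕ)) : M.Pi) :=
  exists_over_coe_cyclotomicRigidity_trans_mk_ofDoubleUnderline C μ hC hS h15 L hl hp2 hpl hζ hη hslimX
    (C.rigidData_cor218_i_of_thm16Inputs μ hC hS h15 L hext₀ hΔ hZ hK hYN h65 hex hcusp) hO hYcl F e hη' α

/-- **[EtTh] Cor. 2.19 (i) (splittings) at the §1 model WITHOUT the named FACT Cor. 2.18 (i)**: abc-iut-L2's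
`cor219_i_splittings_model_of_origin` with `h218i` supplied by `rigidData_cor218_i_of_thm16Inputs` — the model form of
F-0626 modulo the same campaign-M binders. [cite: MochizukiEtTh2009, Cor 2.19(i) p.64] -/
theorem cor219_i_splittings_model_of_thm16Inputs
    (h15 : Literature.AnabelianGeometry.EtaleTheta.ThetaSetting.Prop15iii E hC) (L : C.CuspLabels)
    (hslimX : IsSlimGroup D.PiTemp)
    (hext₀ : ∀ γ : ↥C.Huu ≃ₜ* ↥C.Huu, ∃ Γ : D.PiTemp ≃ₜ* D.PiTemp,
      ∀ h : C.Huu, Γ (h : D.PiTemp) = ((γ h : C.Huu) : D.PiTemp))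
    (hΔ : ∀ Γ : D.PiTemp ≃ₜ* D.PiTemp, D.DeltaTemp.map Γ.toMulEquiv.toMonoidHom = D.DeltaTemp)
    (hZ : Thm16Sub.KerToZIsCompactlyGenerated D) (hK : Thm16Sub.GKNIsKernelOfAction D 2)
    (hYN : Thm16Sub.GtpYNFromCusp D 2) (h65 : D.IsoPreservesCuspidalDecomp D.toTemperedCurve)
    (hex : ∃ Dc : Subgroup D.PiTemp, D.IsCuspidalDecompositionGroup Dc ∧ Dc ≤ D.GtpY)
    (hcusp : ∀ (γ : ↥C.Huu ≃ₜ* ↥C.Huu) (a : ZMod l),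
      (fun H : Subgroup C.Huu => H.map γ.toMulEquiv.toMonoidHom) '' L.cuspX a = L.cuspX a)
    (hO : D.IsEtThOrigin)
    (hYcl : (D.DtpY.map D.toHat.toMonoidHom).topologicalClosure ≤
      D.DtpY.map D.toHat.toMonoidHom ⊔ (⁅⁅D.DeltaHat, D.DeltaHat⁆, D.DeltaHat⁆).topologicalClosure) :
    (C.rigidData μ hC hS h15 L).Cor219_i_splittings :=
  C.cor219_i_splittings_model_of_origin μ hC hS h15 L hslimX
    (C.rigidData_cor218_i_of_thm16Inputs μ hC hS h15 L hext₀ hΔ hZ hK hYN h65 hex hcusp) hO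
    (Literature.AnabelianGeometry.EtaleTheta.ThetaSetting.dtpYTheta_comm D hO) hYcl

end Tate

end ThetaSetting

end Literature.IUT.HodgeArakelov

end
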